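import Literature.MathematicalPhysics.QuantumFieldTheory.Balaban1983to89.NodeOLettersOfWalksWitness

/-!
# `Balaban1983to89.NodeOLettersOfWalksWitnessSym` — WITNESS 3: the two-constant hypothesis list of
# `NodeOLettersOfWalks.termLetters_of_walks₂` inhabited by a SYMMETRIC nearest-neighbour hopping full precision
# `μ_P·1 + F(σ,u) + F(σ,u)ᵀ`, torus-uniformly, with a kernel-checked NON-COLLAPSE certificate `L·H_P^{sym} ≠ 0`

statement-level bookkeeping over published theorems with citation tags; finite-matrix MODELS on the unit torus, kernel-
checked; nothing here is a claim about the Yang–Mills mass gap.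

Cell `pub-ymgap`, D-0062 Track A, node N10 = [Balaban1988RG2Cluster] Lemmas 1–3; seat `dag-n10-b` g5.  WHY.  The cell's discharge
referee, reading `NodeOLettersOfWalksWitness` (p439809; READ-331), LOCATED a model degeneracy in WITNESS 2 (`termLetters_model₂`):
its hopping full precision `P = μ_P·1 + H_P` has `H_P = F` = forward hopping from the FIRST into the SECOND located copy of the
sites only, so `F² = 0` and `L·F = 0` (the local factor `L`'s columns live in the second copy, `F`'s non-zero rows in the
first) — whence `P^{−1/2} = μ_P^{−1/2}(1 − F∕2μ_P)` exactly and the Γ-kernel `G2 = L·P^{−1/2} = μ_P^{−1/2}L` does not see `H_P`: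
the two-constant Combes–Thomas mechanism was exercised in the hypothesis arithmetic, not in the conclusion's content.  The
referee's wish: *"a non-collapsing witness: `H_P` SYMMETRIC (… `inl → inr` + its transpose) so that `L·H_P ≠ 0` and `P^{−1/2}`
is a genuine Combes–Thomas object"*.  This leaf module (the witness file is at the 1 000-line cap) supplies it.
* §1 `append` — the JUXTAPOSITION of two `B13LocalKernelWalks.LocalTerms` data on the same carriers (term index `B₁ ⊕ B₂`):
  `append_kernel` (kernels add), `append_term_inl∕inr`, `append_sigmaCarrying_inl∕inr`, **`isLocal_append`** (locality letters
  with the same `(X, R, λ, r, m_J)` add the multiplicities `n₁ + n₂`).  Generic; reusable for any sum of one-step families.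
* §2 (`dn_up`, `up_injective`: private torus-carrier helpers), **`hopBack er ec`** — BACKWARD nearest-neighbour hopping `er w → ec (w − e_k)`,
  σ-anchored at the bond's base site `w − e_k` (so that term by term it is the located TRANSPOSE of `hopTerms ec er`):
  `hopBack_isLocal` (range `1`, `ν` terms per start site), `im_hopBack_kernel_zero`, `sigmaCarrying_hopBack_nonempty`.
* §3 **`symHop`** `:= append (hopTerms inl inr) (hopBack inr inl)` on `Λ ⊕ C₀` = two located copies of the sites:
  `symHop_isLocal` (`n_B = ν + ν`), `hopBack_term_up` (term `(z + e_k, k)` of the backward half = transpose of term `(z, k)` of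
  the forward half), **`symHop_kernel_transpose`** — `H^{sym}(σ,u)ᵀ = H^{sym}(σ,u)` for ALL `(σ,u)` (reindexing along the bijection
  `(z,k) ↦ (z + e_k, k)`), `massSymHop_transpose` (the precision `μ·1 + H^{sym}` is complex symmetric on polydisc × ball, real
  symmetric at the reference point — print p. 15), `im_symHop_kernel_zero`, `im_massSymHop_zero` (the clause `hP` of
  `modelKernels`), `sigmaCarrying_symHop_nonempty`.
* §4 NON-COLLAPSE at `(σ ≡ 1, u = 0)` (`sigmaOne`, in the polydisc for `κ₁ ≥ 0`): `hop_entry_sigmaOne`, `symHop_entry_sigmaOne`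
  (entries are non-negative reals; `L(z, inr(z+e_{k₀})) ≥ t`, `H^{sym}(inr(z+e_{k₀}), inl z) ≥ t_P` — the row block WITNESS 2 left
  empty), **`re_L_mul_symHop_ge`** (`Re (L·H_P^{sym})(z, inl z) ≥ t·t_P`), **`L_mul_symHop_ne_zero`** (`t, t_P > 0`, one direction).
* §5 **`termLetters_model₃`** — WITNESS 3: `termLetters_of_walks₂` inhabited, on EVERY site torus, by the model term of
  `NodeOLettersOfWalksWitness.modelKernels` with the full precision `μ_P·1 + H_P^{sym}(σ,u)`: torus rate `κ_P = 1`, Combes–Thomas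
  rate `κ = m_P∕(8K̄_Pc_V(½))` (`kapCTsym`, `n_B = 2ν`), rates `⅔κ ∕ ⅓κ`, `c_V = c_V(κ∕3)`, under the torus-INDEPENDENT smallness
  `m_P, m_A > 0` only; every constant a function of `(ν, κ₁, t, t_P, λ_A, μ_P, μ_A, ‖ℓ‖R)`, never of `Nf`;
  `sigmaCarrying_model₃_nonempty` (all four σ-carrying sub-families non-empty).  Proof = WITNESS 2's, by name, with
  `symHop_isLocal` in place of `hopTerms_isLocal` (`jointWalkExpansion_massLocal`, `accretive_massLocal`, `volume_two_cVat`, …).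
WHAT THIS DOES NOT DO: it does not compute `P^{−1/2}` (no closed form is claimed; non-collapse is certified through `L·H_P ≠ 0`
and the symmetry of `P`), and it says NOTHING about Bałaban's kernels.
CITATIONS.  [Balaban1988RG2Cluster] (1.11) p. 5, p. 13, (2.7) p. 13, p. 15 (*"The general case is handled by a perturbative
argument"*; symmetric operators at `(U,0)`), (2.14)–(2.16) pp. 15–16; [Balaban1985BackgroundPropagators] (3.93) p. 410, Thm 3.10
(3.107)–(3.108) p. 416, (3.154) p. 427; [Balaban1984PropagatorsII] Lemma 2.1 (2.61) p. 234.
HONEST FRAMING: MODELS — finite matrices on the unit torus certifying that the hypothesis SHAPE of the (B1) per-term input of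
record is inhabited NON-DEGENERATELY (symmetric, genuinely non-local square root, σ- and u-dependent, volume-uniform) and
NOTHING ELSE; whether Bałaban's `C*Δ_k(σ)C_{Z₀ᶜ}`, `C*Δ_k(σ,𝐔,𝐉)C`, `Δ^{(k)}(Z₀,σ)` admit such expansions ∕ accretivity with
k-uniform constants at complex backgrounds is the in-edge's ([13] = N06 ∕ GAPS G-B9-10) and the NODE 00 pin's content, untouched.
Count-neutral Track-A side landing; NOT a discharge of N10; NOT NODE O; nothing continuum ∕ ℝ⁴ ∕ OS ∕ mass-gap ∕ Clay.  0 `sorry`;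
MODEL `abbrev`∕`def`s only (`append`, `hopBack`, `symHop`, `sigmaOne`, `kapCTsym`), no instance, no notation; standard axioms.
-/

noncomputable section

namespace Literature.MathematicalPhysics.QuantumFieldTheory.Balaban1983to89.NodeOLettersOfWalksWitnessSym

open Metric Set Finset
open scoped Matrix
open Literature.MathematicalPhysics.QuantumFieldTheory.Balaban1983to89
open Literature.MathematicalPhysics.QuantumFieldTheory.Balaban1983to89.B9Thm37GlueTorus
  (torusGeom tdist1 tdist1_nonneg tdist1_triangle tdist1_self tdist1_comm tdist1_up_le')
open Literature.MathematicalPhysics.QuantumFieldTheory.Balaban1983to89.TreeLengthTorus (TPt)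
open Literature.MathematicalPhysics.QuantumFieldTheory.Balaban1983to89.B5TorusCover (UT)
open Literature.MathematicalPhysics.QuantumFieldTheory.Balaban1983to89.B5Leibniz121 (up dn up_dn)
open Literature.MathematicalPhysics.QuantumFieldTheory.Balaban1983to89.B13JointWalkExpansion (JointWalkExpansion)
open Literature.MathematicalPhysics.QuantumFieldTheory.Balaban1983to89.B13LocalKernelWalks (LocalTerms)
open Literature.MathematicalPhysics.QuantumFieldTheory.Balaban1983to89.NodeOLetters (TermLetters)
open Literature.MathematicalPhysics.QuantumFieldTheory.Balaban1983to89.B13Sqrt27Accretive (invSqrt)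
open Literature.MathematicalPhysics.QuantumFieldTheory.Balaban1983to89.NodeOLettersOfWalksWitness
  (hopTerms diagTerms massLocal modelKernels kbarLoc kbarLoc_nonneg kbarPrec mAcc kapCov lamEff cVat cV one_le_cVat
    one_le_c0_pow volume_two_cVat volume_id_cVat jointWalkExpansion_massLocal accretive_massLocal im_hop_kernel_zero
    hopTerms_isLocal diagTerms_isLocal abs_lt_of_mAcc_pos sigmaCarrying_hop_nonempty)

variable {d N' : ℕ} {ν : ℕ} {Nf : Fin ν → ℕ} [∀ i, NeZero (Nf i)]
variable {E : Type*} [NormedAddCommGroup E] [NormedSpace ℂ E]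

/-! ## §1. Juxtaposition of two one-step term data (same carriers): kernels add, locality letters add the multiplicities -/

section Append

variable {p n : Type}

/-- The JUXTAPOSITION of two (1.11)-shape term data on the same carriers: term index `B₁ ⊕ B₂`, every field by cases —
the datum of the kernel family `K₁(σ,u) + K₂(σ,u)` ([B9] (3.107): an expansion is a SUM of terms; two expansions side by
side are one). [cite: Balaban1988RG2Cluster, (1.11) p.5; Balaban1985BackgroundPropagators, (3.107) p.416] -/
abbrev append (H₁ H₂ : LocalTerms d N' ν Nf p n E) : LocalTerms d N' ν Nf p n E where
  B := H₁.B ⊕ H₂.B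
  instFintype := inferInstance
  x := Sum.elim H₁.x H₂.x
  y := Sum.elim H₁.y H₂.y
  J := Sum.elim H₁.J H₂.J
  coef := Sum.elim H₁.coef H₂.coef
  M := Sum.elim H₁.M H₂.M

variable (H₁ H₂ : LocalTerms d N' ν Nf p n E)

/-- The terms of the juxtaposition are the terms of the parts. [cite: Balaban1988RG2Cluster, (1.11) p.5] -/
theorem append_term_inl (b : H₁.B) : (append H₁ H₂).term (Sum.inl b) = H₁.term b := rfl

/-- The terms of the juxtaposition are the terms of the parts. [cite: Balaban1988RG2Cluster, (1.11) p.5] -/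
theorem append_term_inr (b : H₂.B) : (append H₁ H₂).term (Sum.inr b) = H₂.term b := rfl

/-- **The kernel of the juxtaposition is the sum of the kernels** (`Σ` over `B₁ ⊕ B₂` splits). [cite: Balaban1985BackgroundPropagators, (3.107) p.416] -/
theorem append_kernel (σ : TPt d N' → ℂ) (u : E) :
    (append H₁ H₂).kernel σ u = H₁.kernel σ u + H₂.kernel σ u := by
  show (∑ b : H₁.B ⊕ H₂.B, (append H₁ H₂).term b σ u) = (∑ b, H₁.term b σ u) + ∑ b, H₂.term b σ u
  rw [Fintype.sum_sum_type]
  rfl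

/-- The σ-carrying sub-family of the juxtaposition is the union of the parts'. [cite: Balaban1988RG2Cluster, (1.11) p.5] -/
theorem append_sigmaCarrying_inl (b : H₁.B) : Sum.inl b ∈ (append H₁ H₂).sigmaCarrying ↔ b ∈ H₁.sigmaCarrying := Iff.rfl

/-- The σ-carrying sub-family of the juxtaposition is the union of the parts'. [cite: Balaban1988RG2Cluster, (1.11) p.5] -/
theorem append_sigmaCarrying_inr (b : H₂.B) : Sum.inr b ∈ (append H₁ H₂).sigmaCarrying ↔ b ∈ H₂.sigmaCarrying := Iff.rfl

variable {H₁ H₂}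

/-- **LOCALITY LETTERS ADD THE MULTIPLICITIES**: two local data with the same carriers, σ-region, ball, coefficient bound,
range and monomial degree, with `n₁` resp. `n₂` terms per start site, juxtapose to a local datum with `n₁ + n₂` terms per
start site. [cite: Balaban1988RG2Cluster, (1.11) p.5, p.13, p.15; Balaban1985BackgroundPropagators, Thm 3.10 p.416] -/
theorem isLocal_append {c : B13.Consts} {locp : p → UT Nf} {locn : n → UT Nf} {X : Finset (UT Nf)} {R lam r : ℝ}
    {mJ n₁ n₂ : ℕ} (h₁ : H₁.IsLocal c locp locn X R lam r mJ n₁) (h₂ : H₂.IsLocal c locp locn X R lam r mJ n₂) :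
    (append H₁ H₂).IsLocal c locp locn X R lam r mJ (n₁ + n₂) where
  hMle b := by rcases b with b | b; exacts [h₁.hMle b, h₂.hMle b]
  hMsupp b := by rcases b with b | b; exacts [h₁.hMsupp b, h₂.hMsupp b]
  hcoef_an b := by rcases b with b | b; exacts [h₁.hcoef_an b, h₂.hcoef_an b]
  hcoef_bd b := by rcases b with b | b; exacts [h₁.hcoef_bd b, h₂.hcoef_bd b]
  hrange b := by rcases b with b | b; exacts [h₁.hrange b, h₂.hrange b]
  hJ b := by rcases b with b | b; exacts [h₁.hJ b, h₂.hJ b]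
  hX b := by rcases b with b | b; exacts [h₁.hX b, h₂.hX b]
  hmult z := by
    classical
    have hsplit : ((Finset.univ : Finset (H₁.B ⊕ H₂.B)).filter fun b => (append H₁ H₂).x b = z).card =
        ((Finset.univ : Finset H₁.B).filter fun b => H₁.x b = z).card +
          ((Finset.univ : Finset H₂.B).filter fun b => H₂.x b = z).card := by
      rw [Finset.card_filter, Finset.card_filter, Finset.card_filter]
      show (∑ b : H₁.B ⊕ H₂.B, if (append H₁ H₂).x b = z then 1 else 0) = _
      rw [Fintype.sum_sum_type]
      rfl
    calc ((Finset.univ : Finset (append H₁ H₂).B).filter fun b => (append H₁ H₂).x b = z).card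
        = ((Finset.univ : Finset H₁.B).filter fun b => H₁.x b = z).card +
            ((Finset.univ : Finset H₂.B).filter fun b => H₂.x b = z).card := hsplit
      _ ≤ n₁ + n₂ := add_le_add (h₁.hmult z) (h₂.hmult z)

end Append

/-! ## §2. Backward nearest-neighbour hopping `er w → ec (w − e_k)`, σ-anchored at the bond's base site `w − e_k` -/

section Back

/-- `(x + e_μ) − e_μ = x` on the torus carrier (companion of `B5Leibniz121.up_dn`). [folklore] -/
private theorem dn_up (x : UT Nf) (μ : Fin ν) : dn (up x μ) μ = x := by
  unfold up dn
  have h1 : UT.toSite Nf (UT.ofSite Nf (Function.update (UT.toSite Nf x) μ (UT.toSite Nf x μ + 1))) μ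
      = UT.toSite Nf x μ + 1 := by
    show Function.update (UT.toSite Nf x) μ (UT.toSite Nf x μ + 1) μ = _
    rw [Function.update_self]
  rw [h1, add_sub_cancel_right]
  show UT.ofSite Nf (Function.update (Function.update (UT.toSite Nf x) μ (UT.toSite Nf x μ + 1)) μ
    (UT.toSite Nf x μ)) = x
  rw [Function.update_idem, Function.update_eq_self]
  rfl

/-- `w ↦ w + e_k` is injective on the torus carrier (it has the left inverse `· − e_k`). [folklore] -/
private theorem up_injective (k : Fin ν) : Function.Injective fun z : UT Nf => up z k := by
  intro z z' h
  have := congrArg (fun w => dn w k) h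
  simpa [dn_up] using this

variable (Nf)

/-- MODEL. BACKWARD NEAREST-NEIGHBOUR HOPPING between two index types carrying embedded copies of the sites (row embedding
`er`, column embedding `ec`): one term per (site `w`, direction `k`), `er w → ec (w − e_k)`, coefficient `t(1 + ℓ(u))`,
s-monomial `σ_{j₀}` on the terms whose BASE SITE `w − e_k` lies in `X` — so that, term by term, `hopBack ec er` is the located
TRANSPOSE of `hopTerms er ec` (same coefficient and monomial on the bond `{w − e_k, w}`). [cite: Balaban1988RG2Cluster, (1.11) p.5, p.13; Balaban1985BackgroundPropagators, (3.107) p.416] -/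
abbrev hopBack {p n : Type} [DecidableEq p] [DecidableEq n] (er : UT Nf → p) (ec : UT Nf → n) (t : ℝ) (ℓ : E →L[ℂ] ℂ)
    (X : Finset (UT Nf)) (j₀ : TPt d N') : LocalTerms d N' ν Nf p n E where
  B := UT Nf × Fin ν
  x := fun b => b.1
  y := fun b => dn b.1 b.2
  J := fun b => if dn b.1 b.2 ∈ X then {j₀} else ∅
  coef := fun _ u => (t : ℂ) * (1 + ℓ u)
  M := fun b => Matrix.of fun i j => if i = er b.1 ∧ j = ec (dn b.1 b.2) then (1 : ℂ) else 0

variable {Nf}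

/-- The affine coefficient `λ(1 + ℓ(u))` is bounded by `|λ|(1 + ‖ℓ‖R)` on the `R`-ball. [folklore] -/
private theorem coef_bound (lam : ℝ) (ℓ : E →L[ℂ] ℂ) {R : ℝ} {u : E} (hu : u ∈ ball (0 : E) R) :
    ‖(lam : ℂ) * (1 + ℓ u)‖ ≤ |lam| * (1 + ‖ℓ‖ * R) := by
  have hu' : ‖u‖ ≤ R := by simpa using (mem_ball_zero_iff.1 hu).le
  rw [norm_mul, Complex.norm_real, Real.norm_eq_abs]
  refine mul_le_mul_of_nonneg_left ((norm_add_le _ _).trans ?_) (abs_nonneg _)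
  have : ‖ℓ u‖ ≤ ‖ℓ‖ * R := (ℓ.le_opNorm u).trans (mul_le_mul_of_nonneg_left hu' (norm_nonneg _))
  rw [norm_one]; linarith

/-- The backward hopping family is LOCAL for locators retracting the embeddings (`locp ∘ er = id`, `locn ∘ ec = id`): range `1`
(`d₁(w, w − e_k) = d₁((w − e_k) + e_k, w − e_k) ≤ 1`), one s-parameter per term, `ν` terms per start site, coefficient bound
`|t|(1 + ‖ℓ‖R)`, σ-region `X` (a σ-carrying term ENDS in `X`). [cite: Balaban1988RG2Cluster, (1.11) p.5, p.13, p.15] -/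
theorem hopBack_isLocal {p n : Type} [DecidableEq p] [DecidableEq n] (c : B13.Consts) {er : UT Nf → p} {ec : UT Nf → n}
    {locp : p → UT Nf} {locn : n → UT Nf} (her : ∀ z, locp (er z) = z) (hec : ∀ z, locn (ec z) = z) (t : ℝ)
    (ℓ : E →L[ℂ] ℂ) (X : Finset (UT Nf)) (j₀ : TPt d N') (R : ℝ) :
    (hopBack (d := d) (N' := N') Nf er ec t ℓ X j₀).IsLocal c locp locn X R (|t| * (1 + ‖ℓ‖ * R)) 1 1 ν where
  hMle b i j := by
    simp only [Matrix.of_apply]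
    split_ifs <;> simp
  hMsupp b i j h := by
    by_cases hP : i = er b.1 ∧ j = ec (dn b.1 b.2)
    · exact ⟨by rw [hP.1]; exact her _, by rw [hP.2]; exact hec _⟩
    · exact (h (by simp [hP])).elim
  hcoef_an b := (differentiableOn_const _).mul (ℓ.differentiable.differentiableOn.const_add _)
  hcoef_bd b u hu := coef_bound t ℓ hu
  hrange b := by
    have h := tdist1_up_le' (N := Nf) (dn b.1 b.2) b.2
    rwa [up_dn] at h
  hJ b := by
    dsimp only
    split_ifs <;> simp
  hX b hb := by
    by_cases h : dn b.1 b.2 ∈ X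
    · exact Or.inr h
    · simp [h] at hb
  hmult z := by
    classical
    calc (Finset.univ.filter fun b : UT Nf × Fin ν => b.1 = z).card
        ≤ (Finset.image (fun μ : Fin ν => (z, μ)) Finset.univ).card := by
          refine Finset.card_le_card fun b hb => ?_
          simp only [Finset.mem_filter, Finset.mem_univ, true_and] at hb
          exact Finset.mem_image.2 ⟨b.2, Finset.mem_univ _, by rw [← hb]⟩
      _ ≤ (Finset.univ : Finset (Fin ν)).card := Finset.card_image_le
      _ = ν := by simp

/-- At the reference point `σ = 0` an s-monomial is `1` on the empty index set and `0` otherwise. [cite: Balaban1988RG2Cluster, (1.11) p.5] -/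
private theorem monomial_zero (J : Finset (TPt d N')) :
    (∏ j ∈ J, (0 : TPt d N' → ℂ) j) = if J = ∅ then 1 else 0 := by
  rcases J.eq_empty_or_nonempty with h | h
  · simp [h]
  · obtain ⟨j, hj⟩ := h
    rw [Finset.prod_eq_zero hj (by simp), if_neg (Finset.nonempty_iff_ne_empty.1 ⟨j, hj⟩)]

/-- Every term of the backward hopping family is REAL at the reference point. [cite: Balaban1988RG2Cluster, (1.11) p.5, p.15] -/
private theorem im_hopBack_term_zero {p n : Type} [DecidableEq p] [DecidableEq n] (er : UT Nf → p) (ec : UT Nf → n)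
    (t : ℝ) (ℓ : E →L[ℂ] ℂ) (X : Finset (UT Nf)) (j₀ : TPt d N') (b : UT Nf × Fin ν) (i : p) (k : n) :
    ((hopBack (d := d) (N' := N') Nf er ec t ℓ X j₀).term b 0 0 i k).im = 0 := by
  rw [LocalTerms.term_apply]
  have h1 : (∏ j ∈ (hopBack (d := d) (N' := N') (E := E) Nf er ec t ℓ X j₀).J b, (0 : TPt d N' → ℂ) j).im = 0 := by
    rw [monomial_zero]
    split_ifs <;> simp
  have h2 : ((hopBack (d := d) (N' := N') Nf er ec t ℓ X j₀).coef b (0 : E)).im = 0 := by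
    simp
  have h3 : ((hopBack (d := d) (N' := N') (E := E) Nf er ec t ℓ X j₀).M b i k).im = 0 := by
    simp only [Matrix.of_apply]
    split_ifs <;> simp
  rw [Complex.mul_im, Complex.mul_im, h1, h2, h3]
  ring

/-- **The backward hopping kernel is REAL at the reference point.** [cite: Balaban1988RG2Cluster, p.15] -/
theorem im_hopBack_kernel_zero {p n : Type} [DecidableEq p] [DecidableEq n] (er : UT Nf → p) (ec : UT Nf → n) (t : ℝ)
    (ℓ : E →L[ℂ] ℂ) (X : Finset (UT Nf)) (j₀ : TPt d N') (i : p) (k : n) :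
    ((hopBack (d := d) (N' := N') Nf er ec t ℓ X j₀).kernel 0 0 i k).im = 0 := by
  rw [LocalTerms.kernel_apply, Complex.im_sum]
  exact Finset.sum_eq_zero fun b _ => im_hopBack_term_zero er ec t ℓ X j₀ b i k

/-- A backward hopping term whose base site `w − e_k` lies in `X` carries `σ_{j₀}` (the term `(x₀ + e_k, k)` for `x₀ ∈ X`).
[cite: Balaban1988RG2Cluster, (1.11) p.5, p.13] -/
theorem sigmaCarrying_hopBack_nonempty {p n : Type} [DecidableEq p] [DecidableEq n] (er : UT Nf → p) (ec : UT Nf → n)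
    (t : ℝ) (ℓ : E →L[ℂ] ℂ) (j₀ : TPt d N') {X : Finset (UT Nf)} {x₀ : UT Nf} (hx₀ : x₀ ∈ X) (k : Fin ν) :
    (up x₀ k, k) ∈ (hopBack (d := d) (N' := N') Nf er ec t ℓ X j₀).sigmaCarrying := by
  show (if dn (up x₀ k) k ∈ X then ({j₀} : Finset (TPt d N')) else ∅).Nonempty
  rw [dn_up, if_pos hx₀]
  exact Finset.singleton_nonempty j₀

end Back

/-! ## §3. The SYMMETRIC hopping family on two located copies of the sites: `H^{sym} = F + Fᵀ` -/

section Sym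

variable (Nf)

/-- MODEL. **THE SYMMETRIC NEAREST-NEIGHBOUR HOPPING FAMILY** on `Λ ⊕ C₀` = two located copies of the sites: the forward family
`F` = `hopTerms inl inr` (`inl z → inr (z + e_k)`) JUXTAPOSED with its located transpose `hopBack inr inl`
(`inr (z + e_k) → inl z`), both with coefficient `t(1 + ℓ(u))` and s-monomial `σ_{j₀}` exactly on the bonds based in `X`:
`H^{sym}(σ,u) = F(σ,u) + F(σ,u)ᵀ` for ALL `(σ,u)` (`symHop_kernel_transpose`). The cell's discharge referee (READ-331) located
that the one-directional `F` alone gives `F² = 0`, `L·F = 0` — the square root of `μ·1 + F` collapses on the Γ-kernel; the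
symmetric family is the repair. [cite: Balaban1988RG2Cluster, (1.11) p.5, p.13, p.15; Balaban1985BackgroundPropagators, (3.107) p.416] -/
abbrev symHop (t : ℝ) (ℓ : E →L[ℂ] ℂ) (X : Finset (UT Nf)) (j₀ : TPt d N') :
    LocalTerms d N' ν Nf (UT Nf ⊕ UT Nf) (UT Nf ⊕ UT Nf) E :=
  append (hopTerms (d := d) (N' := N') Nf (Sum.inl : UT Nf → UT Nf ⊕ UT Nf) (Sum.inr : UT Nf → UT Nf ⊕ UT Nf) t ℓ X j₀)
    (hopBack (d := d) (N' := N') Nf (Sum.inr : UT Nf → UT Nf ⊕ UT Nf) (Sum.inl : UT Nf → UT Nf ⊕ UT Nf) t ℓ X j₀)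

variable {Nf}

/-- The symmetric hopping family is LOCAL for the locator `Sum.elim id id`: range `1`, one s-parameter per term, `ν + ν` terms
per start site, coefficient bound `|t|(1 + ‖ℓ‖R)`, σ-region `X`. [cite: Balaban1988RG2Cluster, (1.11) p.5, p.13, p.15] -/
theorem symHop_isLocal (c : B13.Consts) (t : ℝ) (ℓ : E →L[ℂ] ℂ) (X : Finset (UT Nf)) (j₀ : TPt d N') (R : ℝ) :
    (symHop (d := d) (N' := N') Nf t ℓ X j₀).IsLocal c (Sum.elim id id) (Sum.elim id id) X R (|t| * (1 + ‖ℓ‖ * R)) 1 1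
      (ν + ν) :=
  isLocal_append
    (hopTerms_isLocal (d := d) (N' := N') c (er := Sum.inl) (ec := Sum.inr) (locp := Sum.elim id id)
      (locn := Sum.elim id id) (fun _ => rfl) (fun _ => rfl) t ℓ X j₀ R)
    (hopBack_isLocal (d := d) (N' := N') c (er := Sum.inr) (ec := Sum.inl) (locp := Sum.elim id id)
      (locn := Sum.elim id id) (fun _ => rfl) (fun _ => rfl) t ℓ X j₀ R)

/-- **TERM BY TERM, the backward family is the transpose of the forward family** after the reindexing `(z,k) ↦ (z + e_k, k)`:
`T^{back}_{(z+e_k,k)}(σ,u) = (T^{fwd}_{(z,k)}(σ,u))ᵀ`. [cite: Balaban1988RG2Cluster, (1.11) p.5] -/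
theorem hopBack_term_up (t : ℝ) (ℓ : E →L[ℂ] ℂ) (X : Finset (UT Nf)) (j₀ : TPt d N') (z : UT Nf) (k : Fin ν)
    (σ : TPt d N' → ℂ) (u : E) :
    (hopBack (d := d) (N' := N') Nf (Sum.inr : UT Nf → UT Nf ⊕ UT Nf) (Sum.inl : UT Nf → UT Nf ⊕ UT Nf) t ℓ X j₀).term (up z k, k) σ u =
      ((hopTerms (d := d) (N' := N') Nf (Sum.inl : UT Nf → UT Nf ⊕ UT Nf) (Sum.inr : UT Nf → UT Nf ⊕ UT Nf) t ℓ X j₀).term (z, k) σ u)ᵀ := by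
  ext i j
  rw [Matrix.transpose_apply, LocalTerms.term_apply, LocalTerms.term_apply]
  have hJ : (hopBack (d := d) (N' := N') (E := E) Nf (Sum.inr : UT Nf → UT Nf ⊕ UT Nf) (Sum.inl : UT Nf → UT Nf ⊕ UT Nf) t ℓ X j₀).J (up z k, k) =
      (hopTerms (d := d) (N' := N') (E := E) Nf (Sum.inl : UT Nf → UT Nf ⊕ UT Nf) (Sum.inr : UT Nf → UT Nf ⊕ UT Nf) t ℓ X j₀).J (z, k) := by
    show (if dn (up z k) k ∈ X then ({j₀} : Finset (TPt d N')) else ∅) = (if z ∈ X then {j₀} else ∅)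
    rw [dn_up]
  have hM : (hopBack (d := d) (N' := N') (E := E) Nf (Sum.inr : UT Nf → UT Nf ⊕ UT Nf) (Sum.inl : UT Nf → UT Nf ⊕ UT Nf) t ℓ X j₀).M (up z k, k) i j =
      (hopTerms (d := d) (N' := N') (E := E) Nf (Sum.inl : UT Nf → UT Nf ⊕ UT Nf) (Sum.inr : UT Nf → UT Nf ⊕ UT Nf) t ℓ X j₀).M (z, k) j i := by
    show (if i = Sum.inr (up z k) ∧ j = Sum.inl (dn (up z k) k) then (1 : ℂ) else 0) =
      (if j = Sum.inl z ∧ i = Sum.inr (up z k) then (1 : ℂ) else 0)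
    rw [dn_up]
    exact if_congr and_comm rfl rfl
  rw [hJ, hM]

/-- **THE SYMMETRIC HOPPING KERNEL IS SYMMETRIC for every `(σ,u)`**: `H^{sym}(σ,u)ᵀ = H^{sym}(σ,u)` — the backward sum,
reindexed along the bijection `(z,k) ↦ (z + e_k, k)` of `UT Nf × Fin ν`, is the transpose of the forward sum. In particular the
model precision `μ·1 + H^{sym}` is COMPLEX SYMMETRIC on polydisc × ball and REAL SYMMETRIC at the reference point (print p. 15:
the quadratic forms at `(U,0)` are symmetric). [cite: Balaban1988RG2Cluster, p.15] -/
theorem symHop_kernel_transpose (t : ℝ) (ℓ : E →L[ℂ] ℂ) (X : Finset (UT Nf)) (j₀ : TPt d N') (σ : TPt d N' → ℂ) (u : E) :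
    ((symHop (d := d) (N' := N') Nf t ℓ X j₀).kernel σ u)ᵀ = (symHop (d := d) (N' := N') Nf t ℓ X j₀).kernel σ u := by
  -- `(z,k) ↦ (z + e_k, k)` is a bijection of the term index
  have hbij : Function.Bijective fun b : UT Nf × Fin ν => (up b.1 b.2, b.2) := by
    have hinj : Function.Injective fun b : UT Nf × Fin ν => (up b.1 b.2, b.2) := by
      rintro ⟨z, k⟩ ⟨z', k'⟩ h
      simp only [Prod.mk.injEq] at h
      obtain ⟨h1, rfl⟩ := h
      exact Prod.ext (up_injective k h1) rfl
    exact ⟨hinj, Finite.surjective_of_injective hinj⟩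
  -- the backward kernel is the transpose of the forward kernel
  have hT : (hopBack (d := d) (N' := N') (E := E) Nf (Sum.inr : UT Nf → UT Nf ⊕ UT Nf) (Sum.inl : UT Nf → UT Nf ⊕ UT Nf) t ℓ X j₀).kernel σ u =
      ((hopTerms (d := d) (N' := N') (E := E) Nf (Sum.inl : UT Nf → UT Nf ⊕ UT Nf) (Sum.inr : UT Nf → UT Nf ⊕ UT Nf) t ℓ X j₀).kernel σ u)ᵀ := by
    show (∑ b : UT Nf × Fin ν, (hopBack (d := d) (N' := N') (E := E) Nf (Sum.inr : UT Nf → UT Nf ⊕ UT Nf) (Sum.inl : UT Nf → UT Nf ⊕ UT Nf) t ℓ X j₀).term b σ u) =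
      (∑ b : UT Nf × Fin ν, (hopTerms (d := d) (N' := N') (E := E) Nf (Sum.inl : UT Nf → UT Nf ⊕ UT Nf) (Sum.inr : UT Nf → UT Nf ⊕ UT Nf) t ℓ X j₀).term b σ u)ᵀ
    rw [Matrix.transpose_sum]
    symm
    exact Fintype.sum_bijective _ hbij _ _ fun b => (hopBack_term_up t ℓ X j₀ b.1 b.2 σ u).symm
  rw [append_kernel, Matrix.transpose_add, hT, Matrix.transpose_transpose, add_comm]

/-- **The symmetric hopping kernel is REAL at the reference point.** [cite: Balaban1988RG2Cluster, p.15] -/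
theorem im_symHop_kernel_zero (t : ℝ) (ℓ : E →L[ℂ] ℂ) (X : Finset (UT Nf)) (j₀ : TPt d N') (i k : UT Nf ⊕ UT Nf) :
    ((symHop (d := d) (N' := N') Nf t ℓ X j₀).kernel 0 0 i k).im = 0 := by
  rw [append_kernel, Matrix.add_apply, Complex.add_im, im_hop_kernel_zero, im_hopBack_kernel_zero, add_zero]

/-- **The model precision `μ·1 + H^{sym}(σ,u)` is REAL at the reference point** (the clause `hP` of `modelKernels`).
[cite: Balaban1988RG2Cluster, p.15] -/
theorem im_massSymHop_zero (μ t : ℝ) (ℓ : E →L[ℂ] ℂ) (X : Finset (UT Nf)) (j₀ : TPt d N') (i k : UT Nf ⊕ UT Nf) :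
    (massLocal (d := d) (N' := N') Nf μ (symHop Nf t ℓ X j₀) 0 (0 : E) i k).im = 0 := by
  show (((μ : ℂ) • (1 : Matrix (UT Nf ⊕ UT Nf) (UT Nf ⊕ UT Nf) ℂ) +
    (symHop (d := d) (N' := N') Nf t ℓ X j₀).kernel 0 (0 : E)) i k).im = 0
  rw [Matrix.add_apply, Complex.add_im, im_symHop_kernel_zero, Matrix.smul_apply, smul_eq_mul, Complex.mul_im,
    Complex.ofReal_re, Complex.ofReal_im]
  by_cases h : i = k
  · subst h; simp
  · simp [Matrix.one_apply_ne h]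

/-- **The model precision `μ·1 + H^{sym}` is SYMMETRIC on polydisc × ball.** [cite: Balaban1988RG2Cluster, p.15] -/
theorem massSymHop_transpose (μ t : ℝ) (ℓ : E →L[ℂ] ℂ) (X : Finset (UT Nf)) (j₀ : TPt d N') (σ : TPt d N' → ℂ) (u : E) :
    (massLocal (d := d) (N' := N') Nf μ (symHop Nf t ℓ X j₀) σ u)ᵀ = massLocal (d := d) (N' := N') Nf μ (symHop Nf t ℓ X j₀) σ u := by
  show ((μ : ℂ) • (1 : Matrix _ _ ℂ) + (symHop (d := d) (N' := N') Nf t ℓ X j₀).kernel σ u)ᵀ = _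
  rw [Matrix.transpose_add, Matrix.transpose_smul, Matrix.transpose_one, symHop_kernel_transpose]

/-- Both halves of the symmetric family have NON-EMPTY σ-carrying sub-families (`x₀ ∈ X`, a direction `k`).
[cite: Balaban1988RG2Cluster, (1.11) p.5, p.13] -/
theorem sigmaCarrying_symHop_nonempty {X : Finset (UT Nf)} {x₀ : UT Nf} (hx₀ : x₀ ∈ X) (k : Fin ν) (t : ℝ) (ℓ : E →L[ℂ] ℂ)
    (j₀ : TPt d N') :
    Sum.inl (x₀, k) ∈ (symHop (d := d) (N' := N') Nf t ℓ X j₀).sigmaCarrying ∧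
      Sum.inr (up x₀ k, k) ∈ (symHop (d := d) (N' := N') Nf t ℓ X j₀).sigmaCarrying :=
  ⟨(append_sigmaCarrying_inl _ _ _).2 (sigmaCarrying_hop_nonempty _ _ t ℓ j₀ hx₀),
    (append_sigmaCarrying_inr _ _ _).2 (sigmaCarrying_hopBack_nonempty _ _ t ℓ j₀ hx₀ k)⟩

end Sym

/-! ## §4. NON-COLLAPSE: at `(σ ≡ 1, u = 0)` the Γ-kernel's local factor SEES the symmetric precision, `L·H_P^{sym} ≠ 0` -/

section NonCollapse

/-- The configuration `σ ≡ 1` (all s-parameters switched on; in the polydisc since `κ₁ ≥ 0`). [cite: Balaban1988RG2Cluster, (1.11) p.5] -/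
abbrev sigmaOne : TPt d N' → ℂ := fun _ => 1

omit [∀ i, NeZero (Nf i)] in
/-- `σ ≡ 1` lies in the polydisc `‖σ_j‖ ≤ e^{κ₁}` for `κ₁ ≥ 0`. [cite: Balaban1988RG2Cluster, (1.11) p.5] -/
theorem sigmaOne_mem {c : B13.Consts} (hκ₁ : 0 ≤ c.κ₁) (j : TPt d N') : ‖(sigmaOne (d := d) (N' := N')) j‖ ≤ Real.exp c.κ₁ := by
  simp only [sigmaOne, norm_one]
  exact Real.one_le_exp hκ₁

/-- A finite sum of terms `if P b then t else 0` (`t ≥ 0` real, as complex numbers) is a non-negative real, and dominates `t` as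
soon as one `P b₀` holds. [folklore] -/
private theorem sum_ite_real {ι : Type} [Fintype ι] (P : ι → Prop) [DecidablePred P] {t : ℝ} (ht : 0 ≤ t) :
    (∑ b, (if P b then (t : ℂ) else 0)).im = 0 ∧ 0 ≤ (∑ b, (if P b then (t : ℂ) else 0)).re ∧
      ∀ b₀, P b₀ → t ≤ (∑ b, (if P b then (t : ℂ) else 0)).re := by
  have hre : ∀ b, (if P b then (t : ℂ) else 0).re = if P b then t else 0 := fun b => by split_ifs <;> simp
  have him : ∀ b, (if P b then (t : ℂ) else 0).im = 0 := fun b => by split_ifs <;> simp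
  have hnn : ∀ b ∈ (Finset.univ : Finset ι), 0 ≤ (fun b => (if P b then (t : ℂ) else 0).re) b := fun b _ => by
    show 0 ≤ (if P b then (t : ℂ) else 0).re
    rw [hre]; split_ifs <;> simp [ht]
  refine ⟨by rw [Complex.im_sum]; exact Finset.sum_eq_zero fun b _ => him b, ?_, fun b₀ hb₀ => ?_⟩
  · rw [Complex.re_sum]
    exact Finset.sum_nonneg hnn
  · rw [Complex.re_sum]
    calc t = (fun b => (if P b then (t : ℂ) else 0).re) b₀ := by show t = (if P b₀ then (t : ℂ) else 0).re; rw [hre, if_pos hb₀]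
      _ ≤ ∑ b, (fun b => (if P b then (t : ℂ) else 0).re) b := Finset.single_le_sum hnn (Finset.mem_univ b₀)

/-- A forward hopping term at `(σ ≡ 1, u = 0)`: `t` on its entry pattern, `0` off it. [cite: Balaban1988RG2Cluster, (1.11) p.5] -/
private theorem hop_term_sigmaOne {p n : Type} [DecidableEq p] [DecidableEq n] (er : UT Nf → p) (ec : UT Nf → n) (t : ℝ)
    (ℓ : E →L[ℂ] ℂ) (X : Finset (UT Nf)) (j₀ : TPt d N') (b : UT Nf × Fin ν) (i : p) (j : n) :
    (hopTerms (d := d) (N' := N') Nf er ec t ℓ X j₀).term b sigmaOne (0 : E) i j =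
      if i = er b.1 ∧ j = ec (up b.1 b.2) then (t : ℂ) else 0 := by
  rw [LocalTerms.term_apply]
  have h1 : (∏ j ∈ (hopTerms (d := d) (N' := N') (E := E) Nf er ec t ℓ X j₀).J b, (sigmaOne (d := d) (N' := N')) j) = 1 :=
    Finset.prod_eq_one fun _ _ => rfl
  have h2 : (hopTerms (d := d) (N' := N') Nf er ec t ℓ X j₀).coef b (0 : E) = (t : ℂ) := by
    show (t : ℂ) * (1 + ℓ 0) = t
    simp
  have h3 : (hopTerms (d := d) (N' := N') (E := E) Nf er ec t ℓ X j₀).M b i j =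
      if i = er b.1 ∧ j = ec (up b.1 b.2) then (1 : ℂ) else 0 := rfl
  rw [h1, h2, h3, one_mul]
  split_ifs <;> simp

/-- A backward hopping term at `(σ ≡ 1, u = 0)`: `t` on its entry pattern, `0` off it. [cite: Balaban1988RG2Cluster, (1.11) p.5] -/
private theorem hopBack_term_sigmaOne {p n : Type} [DecidableEq p] [DecidableEq n] (er : UT Nf → p) (ec : UT Nf → n) (t : ℝ)
    (ℓ : E →L[ℂ] ℂ) (X : Finset (UT Nf)) (j₀ : TPt d N') (b : UT Nf × Fin ν) (i : p) (j : n) :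
    (hopBack (d := d) (N' := N') Nf er ec t ℓ X j₀).term b sigmaOne (0 : E) i j =
      if i = er b.1 ∧ j = ec (dn b.1 b.2) then (t : ℂ) else 0 := by
  rw [LocalTerms.term_apply]
  have h1 : (∏ j ∈ (hopBack (d := d) (N' := N') (E := E) Nf er ec t ℓ X j₀).J b, (sigmaOne (d := d) (N' := N')) j) = 1 :=
    Finset.prod_eq_one fun _ _ => rfl
  have h2 : (hopBack (d := d) (N' := N') Nf er ec t ℓ X j₀).coef b (0 : E) = (t : ℂ) := by
    show (t : ℂ) * (1 + ℓ 0) = t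
    simp
  have h3 : (hopBack (d := d) (N' := N') (E := E) Nf er ec t ℓ X j₀).M b i j =
      if i = er b.1 ∧ j = ec (dn b.1 b.2) then (1 : ℂ) else 0 := rfl
  rw [h1, h2, h3, one_mul]
  split_ifs <;> simp

/-- **The local factor's entry `L(z, m)` at `(σ ≡ 1, u = 0)` is a non-negative real, `≥ t` at `m = inr(z + e_{k₀})`** (`t ≥ 0`):
the hopping term `(z, k₀)` contributes `t`, every other term `0` or `t`. [cite: Balaban1988RG2Cluster, (1.11) p.5] -/
theorem hop_entry_sigmaOne {t : ℝ} (ht : 0 ≤ t) (ℓ : E →L[ℂ] ℂ) (X : Finset (UT Nf)) (j₀ : TPt d N') (z : UT Nf) (k₀ : Fin ν)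
    (m : UT Nf ⊕ UT Nf) :
    ((hopTerms (d := d) (N' := N') Nf id (Sum.inr : UT Nf → UT Nf ⊕ UT Nf) t ℓ X j₀).kernel sigmaOne (0 : E) z m).im = 0 ∧
      0 ≤ ((hopTerms (d := d) (N' := N') Nf id (Sum.inr : UT Nf → UT Nf ⊕ UT Nf) t ℓ X j₀).kernel sigmaOne (0 : E) z m).re ∧
      (m = Sum.inr (up z k₀) → t ≤ ((hopTerms (d := d) (N' := N') Nf id (Sum.inr : UT Nf → UT Nf ⊕ UT Nf) t ℓ X j₀).kernel sigmaOne (0 : E) z m).re) := by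
  rw [LocalTerms.kernel_apply]
  simp only [hop_term_sigmaOne]
  obtain ⟨h1, h2, h3⟩ := sum_ite_real (fun b : UT Nf × Fin ν => z = id b.1 ∧ m = Sum.inr (up b.1 b.2)) ht
  exact ⟨h1, h2, fun hm => h3 (z, k₀) ⟨rfl, hm⟩⟩

/-- **The symmetric precision's entry `H_P^{sym}(m, inl z)` at `(σ ≡ 1, u = 0)` is a non-negative real, `≥ t_P` at
`m = inr(z + e_{k₀})`** (`t_P ≥ 0`): the transpose term `(z + e_{k₀}, k₀)` contributes `t_P` (its column is
`inl((z + e_{k₀}) − e_{k₀}) = inl z`), the forward terms contribute `0` there (their columns live in the second copy), every other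
term `0` or `t_P`.  This is the row block that the one-directional family of WITNESS 2 leaves EMPTY. [cite: Balaban1988RG2Cluster, (1.11) p.5, p.15] -/
theorem symHop_entry_sigmaOne {tP : ℝ} (htP : 0 ≤ tP) (ℓ : E →L[ℂ] ℂ) (X : Finset (UT Nf)) (j₀ : TPt d N') (z : UT Nf)
    (k₀ : Fin ν) (m : UT Nf ⊕ UT Nf) :
    ((symHop (d := d) (N' := N') Nf tP ℓ X j₀).kernel sigmaOne (0 : E) m (Sum.inl z)).im = 0 ∧
      0 ≤ ((symHop (d := d) (N' := N') Nf tP ℓ X j₀).kernel sigmaOne (0 : E) m (Sum.inl z)).re ∧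
      (m = Sum.inr (up z k₀) → tP ≤ ((symHop (d := d) (N' := N') Nf tP ℓ X j₀).kernel sigmaOne (0 : E) m (Sum.inl z)).re) := by
  rw [append_kernel, Matrix.add_apply, LocalTerms.kernel_apply, LocalTerms.kernel_apply]
  simp only [hop_term_sigmaOne, hopBack_term_sigmaOne]
  obtain ⟨f1, f2, -⟩ := sum_ite_real
    (fun b : UT Nf × Fin ν => m = Sum.inl b.1 ∧ (Sum.inl z : UT Nf ⊕ UT Nf) = Sum.inr (up b.1 b.2)) htP
  obtain ⟨b1, b2, b3⟩ := sum_ite_real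
    (fun b : UT Nf × Fin ν => m = Sum.inr b.1 ∧ (Sum.inl z : UT Nf ⊕ UT Nf) = Sum.inl (dn b.1 b.2)) htP
  refine ⟨by rw [Complex.add_im, f1, b1, add_zero], by rw [Complex.add_re]; exact add_nonneg f2 b2, fun hm => ?_⟩
  rw [Complex.add_re]
  have := b3 (up z k₀, k₀) ⟨hm, by rw [dn_up]⟩
  linarith

/-- **NON-COLLAPSE OF WITNESS 3**: at the configuration `(σ ≡ 1, u = 0)` and for non-negative couplings `t, t_P`, in every
direction `k₀` and at every site `z`, `Re (L·H_P^{sym})(z, inl z) ≥ t·t_P` — all summands of the matrix product are non-negative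
reals and the pair `m = inr(z + e_{k₀})` contributes `≥ t·t_P`.  So for `t, t_P > 0` the local factor `L` (columns in the second
copy) composes NON-TRIVIALLY with the symmetric precision (whose transpose half has its rows in the second copy), and the Γ-kernel
`G2 = L·(μ_P·1 + H_P^{sym})^{−1/2}` is not the multiple `μ_P^{−1/2}L` of `L` that the one-directional family produced (READ-331:
`L·F = 0`, `F² = 0`). [cite: Balaban1988RG2Cluster, (2.7) p.13, (2.14) p.15] -/
theorem re_L_mul_symHop_ge {t tP : ℝ} (ht : 0 ≤ t) (htP : 0 ≤ tP) (ℓ : E →L[ℂ] ℂ) (X : Finset (UT Nf)) (j₀ : TPt d N')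
    (z : UT Nf) (k₀ : Fin ν) :
    t * tP ≤ (((hopTerms (d := d) (N' := N') Nf id (Sum.inr : UT Nf → UT Nf ⊕ UT Nf) t ℓ X j₀).kernel sigmaOne (0 : E) *
      (symHop (d := d) (N' := N') Nf tP ℓ X j₀).kernel sigmaOne (0 : E)) z (Sum.inl z)).re := by
  rw [Matrix.mul_apply, Complex.re_sum]
  have hsummand : ∀ m ∈ (Finset.univ : Finset (UT Nf ⊕ UT Nf)),
      0 ≤ (fun m => ((hopTerms (d := d) (N' := N') Nf id (Sum.inr : UT Nf → UT Nf ⊕ UT Nf) t ℓ X j₀).kernel sigmaOne (0 : E) z m *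
        (symHop (d := d) (N' := N') Nf tP ℓ X j₀).kernel sigmaOne (0 : E) m (Sum.inl z)).re) m := by
    intro m _
    obtain ⟨l1, l2, -⟩ := hop_entry_sigmaOne (Nf := Nf) ht ℓ X j₀ z k₀ m
    obtain ⟨s1, s2, -⟩ := symHop_entry_sigmaOne (Nf := Nf) htP ℓ X j₀ z k₀ m
    show 0 ≤ ((hopTerms (d := d) (N' := N') Nf id (Sum.inr : UT Nf → UT Nf ⊕ UT Nf) t ℓ X j₀).kernel sigmaOne (0 : E) z m * (symHop (d := d) (N' := N') Nf tP ℓ X j₀).kernel sigmaOne (0 : E) m (Sum.inl z)).re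
    rw [Complex.mul_re, l1, s1, mul_zero, sub_zero]
    exact mul_nonneg l2 s2
  have hmain : t * tP ≤ (fun m => ((hopTerms (d := d) (N' := N') Nf id (Sum.inr : UT Nf → UT Nf ⊕ UT Nf) t ℓ X j₀).kernel sigmaOne (0 : E) z m *
        (symHop (d := d) (N' := N') Nf tP ℓ X j₀).kernel sigmaOne (0 : E) m (Sum.inl z)).re) (Sum.inr (up z k₀)) := by
    obtain ⟨l1, -, l3⟩ := hop_entry_sigmaOne (Nf := Nf) ht ℓ X j₀ z k₀ (Sum.inr (up z k₀))
    obtain ⟨s1, -, s3⟩ := symHop_entry_sigmaOne (Nf := Nf) htP ℓ X j₀ z k₀ (Sum.inr (up z k₀))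
    show t * tP ≤ ((hopTerms (d := d) (N' := N') Nf id (Sum.inr : UT Nf → UT Nf ⊕ UT Nf) t ℓ X j₀).kernel sigmaOne (0 : E) z (Sum.inr (up z k₀)) *
      (symHop (d := d) (N' := N') Nf tP ℓ X j₀).kernel sigmaOne (0 : E) (Sum.inr (up z k₀)) (Sum.inl z)).re
    rw [Complex.mul_re, l1, s1, mul_zero, sub_zero]
    exact mul_le_mul (l3 rfl) (s3 rfl) htP ((l3 rfl).trans' ht)
  exact hmain.trans (Finset.single_le_sum hsummand (Finset.mem_univ _))

/-- **COROLLARY: `L·H_P^{sym} ≠ 0`** at `(σ ≡ 1, u = 0)` for `t, t_P > 0`, on any torus with at least one direction `k₀`.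
[cite: Balaban1988RG2Cluster, (2.7) p.13, (2.14) p.15] -/
theorem L_mul_symHop_ne_zero {t tP : ℝ} (ht : 0 < t) (htP : 0 < tP) (ℓ : E →L[ℂ] ℂ) (X : Finset (UT Nf)) (j₀ : TPt d N')
    (z : UT Nf) (k₀ : Fin ν) :
    (hopTerms (d := d) (N' := N') Nf id (Sum.inr : UT Nf → UT Nf ⊕ UT Nf) t ℓ X j₀).kernel sigmaOne (0 : E) *
      (symHop (d := d) (N' := N') Nf tP ℓ X j₀).kernel sigmaOne (0 : E) ≠ 0 := by
  intro h
  have h1 := re_L_mul_symHop_ge (Nf := Nf) ht.le htP.le ℓ X j₀ z k₀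
  rw [h, Matrix.zero_apply, Complex.zero_re] at h1
  exact absurd h1 (not_le.2 (mul_pos ht htP))

end NonCollapse

/-! ## §5. WITNESS 3 — the two-constant `termLetters_of_walks₂` with the SYMMETRIC hopping full precision `μ_P·1 + H_P^{sym}` -/

section WitnessThree

/-- `λ′ ≥ 0` for `R ≥ 0`. [folklore] -/
private theorem lamEff_nonneg (lam : ℝ) (ℓ : E →L[ℂ] ℂ) {R : ℝ} (hR : 0 ≤ R) : 0 ≤ lamEff lam ℓ R := by
  unfold lamEff
  have : 0 ≤ ‖ℓ‖ * R := mul_nonneg (norm_nonneg _) hR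
  positivity

omit [∀ i, NeZero (Nf i)] in
/-- The identity locator has fibres of size `≤ 1`. [folklore] -/
private theorem hfib_id (z : UT Nf) : (Finset.univ.filter fun b : UT Nf => id b = z).card ≤ 1 := by
  rw [show (Finset.univ.filter fun b : UT Nf => id b = z) = {z} by ext i; simp]
  simp

/-- The Combes–Thomas rate `κ = m_P∕(8K̄_Pc_V₀)` of the SYMMETRIC hopping full precision (`n_B = 2ν` terms per start site) at
torus rate `κ_P = 1` (walk rate `4`), with the rate-`½` volume constant `c_V₀ = c_V(½)`: `8K̄_Pκc_V₀ = m_P·κ_P` on the nose.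
[cite: Balaban1988RG2Cluster, (2.7) p.13, (2.16) p.16] -/
def kapCTsym (c : B13.Consts) (μP tP : ℝ) (ℓ : E →L[ℂ] ℂ) (R : ℝ) (ν : ℕ) : ℝ :=
  mAcc c μP tP ℓ R 1 (ν + ν) ν / (8 * kbarPrec c μP tP ℓ R 1 4 (ν + ν) ν * cVat (1 / 2) ν)

/-- **WITNESS 3: THE TWO-CONSTANT `termLetters_of_walks₂` IS INHABITED BY A SYMMETRIC FINITE-DIFFERENCE-TYPE PRECISION,
torus-uniformly, with non-empty σ-carrying families — the non-collapsing witness asked for by the cell's discharge referee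
(READ-331).**  Full precision `P = μ_P·1 + H_P^{sym}(σ,u)`, `H_P^{sym} = F + Fᵀ` the SYMMETRIC nearest-neighbour hopping between the
two located copies of the sites (`symHop`: coupling `t_P(1 + ℓ(u))`, `σ_{j₀}` on the bonds based in `X`; `P(σ,u)ᵀ = P(σ,u)`,
`massSymHop_transpose`) — so `P^{−1/2}` is a genuine Neumann ∕ Combes–Thomas object of unbounded range and the Γ-kernel
`G2 = L·P^{−1/2}` sees `H_P` (`L`'s columns and `Fᵀ`'s rows both live in the second copy); torus rate `κ_P = 1`, the
Combes–Thomas condition on its own volume constant `c_V₀ = c_V(½)`; term precision `A2 = μ_A·1 + D_A` diagonal, local factor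
`L` hopping (coupling `t`).  Hypotheses: `κ₁ ≥ 0`, `X ≠ ∅`, `R > 0`, `μ_P, μ_A > 0` and the torus-INDEPENDENT smallness
`m_P > 0` (`NodeOLettersOfWalksWitness.mAcc_eq` with `n_B = 2ν`), `m_A > 0`.  Rates: `κ = m_P∕(8K̄_Pc_V₀)` (`kapCTsym`),
`(θ′, ρ_L, ρ₀) = ⅔κ`, `(η, ρ′) = ⅓κ`, `ρ_E = 2`, `c_V = c_V(κ∕3)`, `κ_C = min(½, m_A∕(4K̄_Ac_V))`.  Conclusion: `TermLetters` of
the model term at rate `ρ′ = κ∕3 > 0`, covariance rate `κ_C > 0`, every constant a function of `(ν, κ₁, t, t_P, λ_A, μ_P, μ_A,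
‖ℓ‖R)` only — NO dependence on `Nf`.  NOTHING about Bałaban's kernels. [cite: Balaban1988RG2Cluster, (2.7) p.13, p.15, (2.14)–(2.16) pp.15–16; Balaban1985BackgroundPropagators, Thm 3.10 p.416, (3.154) p.427; Balaban1984PropagatorsII, (2.61) p.234] -/
theorem termLetters_model₃ (c : B13.Consts) (hκ₁ : 0 ≤ c.κ₁) {X : Finset (UT Nf)} (hX : X.Nonempty) (j₀ : TPt d N')
    (ℓ : E →L[ℂ] ℂ) {R : ℝ} (hR : 0 < R) (t : ℝ) {μP tP μA lamA : ℝ} (hμP : 0 < μP) (hμA : 0 < μA)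
    (hmP : 0 < mAcc c μP tP ℓ R 1 (ν + ν) ν) (hmA : 0 < mAcc c μA lamA ℓ R 0 1 ν) :
    TermLetters (modelKernels (d := d) (N' := N') Nf c X j₀ ℓ t
        (massLocal Nf μP (symHop Nf tP ℓ X j₀)) (im_massSymHop_zero μP tP ℓ X j₀)
        hμA (abs_lt_of_mAcc_pos c hκ₁ ℓ hR.le le_rfl le_rfl hmA))
      R (kapCTsym c μP tP ℓ R ν / 3) (kapCov c μA lamA ℓ R (cVat (kapCTsym c μP tP ℓ R ν / 3) ν) ν)
      (kbarLoc c (lamEff t ℓ R) 1 5 ν ν * (4 / Real.sqrt (mAcc c μP tP ℓ R 1 (ν + ν) ν)) * cVat (kapCTsym c μP tP ℓ R ν / 3) ν)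
      ((2 * kbarLoc c (lamEff t ℓ R) 1 5 ν ν * (4 / Real.sqrt (mAcc c μP tP ℓ R 1 (ν + ν) ν)) +
        kbarLoc c (lamEff t ℓ R) 1 5 ν ν * (16 * (2 * kbarPrec c μP tP ℓ R 1 4 (ν + ν) ν) *
          cVat (kapCTsym c μP tP ℓ R ν / 3) ν ^ 2 /
            (mAcc c μP tP ℓ R 1 (ν + ν) ν * Real.sqrt (mAcc c μP tP ℓ R 1 (ν + ν) ν)))) *
        cVat (kapCTsym c μP tP ℓ R ν / 3) ν)
      (kbarPrec c μA lamA ℓ R 0 0 1 ν) (2 * kbarPrec c μA lamA ℓ R 0 0 1 ν) (4 / mAcc c μA lamA ℓ R 0 1 ν) 0 := by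
  have hR0 : 0 ≤ R := hR.le
  have hℓR : 0 ≤ ‖ℓ‖ * R := mul_nonneg (norm_nonneg _) hR0
  have hc0 := one_le_c0_pow (ν := ν) one_pos
  have htP := lamEff_nonneg tP ℓ hR0
  have htA := lamEff_nonneg lamA ℓ hR0
  -- the constants
  set κ := kapCTsym c μP tP ℓ R ν with hκdef
  have hcV₀ : 1 ≤ cVat (1 / 2) ν := one_le_cVat (by norm_num)
  have hKHP : 0 ≤ kbarLoc c (lamEff tP ℓ R) 1 4 (ν + ν) ν := kbarLoc_nonneg c htP 1 4 (ν + ν) ν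
  have hKDA : 0 ≤ kbarLoc c (lamEff lamA ℓ R) 0 0 1 ν := kbarLoc_nonneg c htA 0 0 1 ν
  have hKP : 0 < kbarPrec c μP tP ℓ R 1 4 (ν + ν) ν := by unfold kbarPrec; linarith
  have hKA : 0 < kbarPrec c μA lamA ℓ R 0 0 1 ν := by unfold kbarPrec; linarith
  have hmK : mAcc c μP tP ℓ R 1 (ν + ν) ν ≤ kbarPrec c μP tP ℓ R 1 4 (ν + ν) ν := by
    have h1 : 0 ≤ kbarLoc c (lamEff tP ℓ R) 1 2 (ν + ν) ν * cV ν :=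
      mul_nonneg (kbarLoc_nonneg c htP 1 2 (ν + ν) ν) (zero_le_one.trans (one_le_cVat one_pos))
    unfold mAcc kbarPrec; linarith
  have hκpos : 0 < κ := by rw [hκdef]; unfold kapCTsym; positivity
  have hκ8 : κ ≤ 1 / 8 := by
    rw [hκdef]; unfold kapCTsym
    rw [div_le_iff₀ (by positivity)]
    nlinarith [hmK, hKP.le, hcV₀, hmP.le]
  have hκm : 8 * kbarPrec c μP tP ℓ R 1 4 (ν + ν) ν * κ * cVat (1 / 2) ν = mAcc c μP tP ℓ R 1 (ν + ν) ν * 1 := by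
    rw [hκdef]; unfold kapCTsym
    field_simp
  have hη : 0 < κ / 3 := by positivity
  have hcVη : 0 < cVat (κ / 3) ν := zero_lt_one.trans_le (one_le_cVat hη)
  have hκC : 0 < kapCov c μA lamA ℓ R (cVat (κ / 3) ν) ν := lt_min (by norm_num) (by positivity)
  -- the three joint walk expansions
  have hJL₀ := LocalTerms.jointWalkExpansion_local_c0
    (hopTerms_isLocal (d := d) (N' := N') c (er := id) (ec := Sum.inr) (locp := id) (locn := Sum.elim id id)
      (fun _ => rfl) (fun _ => rfl) t ℓ X j₀ R) hκ₁
    (by positivity) (ρ := 5) (ε := 2) (κ := 2) (μ := 1) (by norm_num) (by norm_num) one_pos (by norm_num)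
  have hJL : JointWalkExpansion c id (Sum.elim id id) (hopTerms (d := d) (N' := N') Nf id Sum.inr t ℓ X j₀).kernel X R 2 2
      (kbarLoc c (lamEff t ℓ R) 1 5 ν ν) _ _ _ _ 5 :=
    hJL₀.mono le_rfl le_rfl le_rfl (by positivity) (le_of_eq (by simp [kbarLoc, lamEff]))
  have hHP := symHop_isLocal (d := d) (N' := N') (Nf := Nf) c tP ℓ X j₀ R
  have hJP₀ := jointWalkExpansion_massLocal (d := d) (N' := N') c hκ₁ hHP htP hμP.le (kap := 1) zero_le_one
  have hJP : JointWalkExpansion c (Sum.elim id id) (Sum.elim id id)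
      (massLocal (d := d) (N' := N') Nf μP (symHop Nf tP ℓ X j₀)) X R 2 1
      (kbarPrec c μP tP ℓ R 1 4 (ν + ν) ν) _ _ _ _ (1 + 3) :=
    hJP₀.mono le_rfl le_rfl le_rfl (add_nonneg hμP.le (kbarLoc_nonneg c htP _ _ _ _))
      (le_of_eq (by simp only [kbarPrec, kbarLoc, lamEff]; norm_num))
  have hJA₀ := jointWalkExpansion_massLocal (d := d) (N' := N') c hκ₁ (diagTerms_isLocal c id hfib_id lamA ℓ X j₀ R) htA
    hμA.le (kap := 2) (by norm_num)
  have hJA : JointWalkExpansion c id id (massLocal (d := d) (N' := N') Nf μA (diagTerms Nf id lamA ℓ X j₀)) X R 2 2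
      (kbarPrec c μA lamA ℓ R 0 0 1 ν) _ _ _ _ (2 + 3) :=
    hJA₀.mono le_rfl le_rfl le_rfl (add_nonneg hμA.le (kbarLoc_nonneg c htA _ _ _ _))
      (le_of_eq (by simp [kbarPrec, kbarLoc, lamEff]))
  -- the two accretivity constants
  have hPacc := accretive_massLocal (d := d) (N' := N') c hκ₁ hHP htP
    (fun i => (volume_two_cVat (Nf := Nf) one_pos _).1) μP
  have hAacc := accretive_massLocal (d := d) (N' := N') c hκ₁ (diagTerms_isLocal c id hfib_id lamA ℓ X j₀ R) htA
    (fun i => volume_id_cVat (Nf := Nf) one_pos _) μA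
  -- the Combes–Thomas smallness of the covariance against `c_V(κ/3)`
  have hκCm : 8 * kbarPrec c μA lamA ℓ R 0 0 1 ν * kapCov c μA lamA ℓ R (cVat (κ / 3) ν) ν * cVat (κ / 3) ν ≤
      mAcc c μA lamA ℓ R 0 1 ν * 2 := by
    calc 8 * kbarPrec c μA lamA ℓ R 0 0 1 ν * kapCov c μA lamA ℓ R (cVat (κ / 3) ν) ν * cVat (κ / 3) ν
        ≤ 8 * kbarPrec c μA lamA ℓ R 0 0 1 ν *
            (mAcc c μA lamA ℓ R 0 1 ν / (4 * kbarPrec c μA lamA ℓ R 0 0 1 ν * cVat (κ / 3) ν)) * cVat (κ / 3) ν := by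
          gcongr
          exact min_le_right _ _
      _ = mAcc c μA lamA ℓ R 0 1 ν * 2 := by
          field_simp
          ring
  exact NodeOLettersOfWalks.termLetters_of_walks₂
    (modelKernels (d := d) (N' := N') Nf c X j₀ ℓ t
      (massLocal Nf μP (symHop Nf tP ℓ X j₀)) (im_massSymHop_zero μP tP ℓ X j₀)
      hμA (abs_lt_of_mAcc_pos c hκ₁ ℓ hR.le le_rfl le_rfl hmA))
    hX (hopTerms (d := d) (N' := N') Nf id Sum.inr t ℓ X j₀).kernel
    (massLocal (d := d) (N' := N') Nf μP (symHop Nf tP ℓ X j₀)) (fun σ u => rfl) hR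
    hJL (by norm_num) (by norm_num)
    hJP (by norm_num) one_pos hmP hPacc
    hJA (by norm_num) (by norm_num) hmA hAacc
    (cV₀ := cVat (1 / 2) ν) (η := κ / 3) (cV := cVat (κ / 3) ν) (Rσ := 0)
    (fun i => (volume_two_cVat (Nf := Nf) (by norm_num) _).1) hη.le hcVη.le
    (fun i => (volume_two_cVat (Nf := Nf) hη _).1) (fun j => (volume_two_cVat (Nf := Nf) hη _).2)
    (fun i => (volume_two_cVat (Nf := Nf) hη _).1) (fun i => volume_id_cVat (Nf := Nf) hη _)
    (fun b z _ => tdist1_nonneg _ _)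
    (κ := κ) (θ' := 2 * κ / 3) (ρL := 2 * κ / 3) (ρE := 2)
    (κC := kapCov c μA lamA ℓ R (cVat (κ / 3) ν) ν) (ρ₀ := 2 * κ / 3) (ρ' := κ / 3)
    hκpos.le (by linarith) hκm.le
    (by positivity) (by linarith) (by linarith)
    (by linarith) (by linarith)
    (by norm_num) (by norm_num) (by norm_num) (by linarith)
    hκC.le (min_le_left _ _ |>.trans (by norm_num)) hκCm
    hη.le (by linarith) le_rfl le_rfl (by linarith)

/-- **In WITNESS 3 every σ-carrying sub-family is NON-EMPTY** (`x₀ ∈ X`, a direction `k`): the hopping terms `(x₀, k)` of `L`,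
BOTH halves of `H_P^{sym}` (the forward bond `(x₀, k)` and its transpose `(x₀ + e_k, k)`), and the diagonal term of `D_A` at `x₀`
carry `σ_{j₀}`. [cite: Balaban1988RG2Cluster, (1.11) p.5, p.13; Balaban1985BackgroundPropagators, (3.154) p.427] -/
theorem sigmaCarrying_model₃_nonempty {X : Finset (UT Nf)} {x₀ : UT Nf} (hx₀ : x₀ ∈ X) (k : Fin ν) (t tP lamA : ℝ)
    (ℓ : E →L[ℂ] ℂ) (j₀ : TPt d N') :
    (x₀, k) ∈ (hopTerms (d := d) (N' := N') Nf id (Sum.inr : UT Nf → UT Nf ⊕ UT Nf) t ℓ X j₀).sigmaCarrying ∧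
      Sum.inl (x₀, k) ∈ (symHop (d := d) (N' := N') Nf tP ℓ X j₀).sigmaCarrying ∧
      Sum.inr (up x₀ k, k) ∈ (symHop (d := d) (N' := N') Nf tP ℓ X j₀).sigmaCarrying ∧
      x₀ ∈ (diagTerms (d := d) (N' := N') Nf id lamA ℓ X j₀).sigmaCarrying :=
  ⟨sigmaCarrying_hop_nonempty _ _ t ℓ j₀ hx₀, (sigmaCarrying_symHop_nonempty hx₀ k tP ℓ j₀).1,
    (sigmaCarrying_symHop_nonempty hx₀ k tP ℓ j₀).2,
    NodeOLettersOfWalksWitness.sigmaCarrying_diag_nonempty _ lamA ℓ j₀ hx₀⟩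

end WitnessThree

end Literature.MathematicalPhysics.QuantumFieldTheory.Balaban1983to89.NodeOLettersOfWalksWitnessSym

end
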